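import Summits.AnomalousDissipation.AnomalousDissipation.Theorems.BaireTransferRobustLoudUpgradeStubMalkinBordered
import Summits.AnomalousDissipation.AnomalousDissipation.Theorems.BaireTransferRobustLoudUpgradeStubBorderedCone

/-!
# Stub `stub_malkinConeSteady` of the line `malkin-cone-group-orbits` (crux stmt-AnomalousDissipation-1144):
# `malkinSteady S a E ε ⊆ closure (interior (loud S a E ε))` — THE LEVER of the idea card, as a theorem

Registered signature (skeleton v2, planner's crux-plan round 1; proved here textually):
`theorem stub_malkinConeSteady : ∀ (S : Finset (Fin 3 → ℤ)) (a E ε : ℝ), malkinSteady S a E ε ⊆ closure (interior (loud S a E ε))`.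

A Goldstone-degenerate mean-zero steady circle of a lattice-invariant force with ONE first-order-visible symmetry-breaking mode
(`malkinSteady`) is a limit of force-open loudness, for EVERY frequency set `S` (no stock, no transversality in the force, no
hyperbolicity).  It is the composite of the two landed halves of the lead's reshape v3: the BORDERED steady implicit function
theorem `MalkinBordered.stub_malkinBordered : malkinSteady ⊆ borderedSteady` (one IFT for the lattice steady Navier–Stokes map
bordered by the visible breaking force `f_d` and a phase condition — Fredholm alternative + Hahn–Banach —
`Literature/Analysis/Calculus/BorderedImplicitFunction.lean`, `Literature/Analysis/FluidPDE/SteadyNSLatticeLinearised.lean`) and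
the finite-dimensional cone argument on the `T³`-orbit `BorderedCone.stub_borderedCone : borderedSteady ⊆ closure (interior loud)`
(characters along the lattice flow, zero mean of breaking vectors by roots of unity, intermediate value theorem, cone engine).
Sources: A. Vanderbauwhede, *Local Bifurcation and Symmetry* (1982), Ch. 8 (Thm 8.2.11, §8.5); E. N. Dancer, Proc. LMS (1984)
(perturbation of zeros in the presence of symmetries); S.-N. Chow, J. K. Hale, *Methods of Bifurcation Theory* (1982) (bordered
operators).  Pure proof file.
-/

-- `Summit.<Summit>.<Problem>` is the tree's mandated summit-side namespace (CONVENTIONS §2); for this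
-- single-conjunct summit the two coincide, so the duplicate is deliberate.
set_option linter.dupNamespace false

noncomputable section

namespace Summit.AnomalousDissipation.AnomalousDissipation.Theorems.RobustLoudUpgrade.MalkinConeSteady

/-- **The registered stub `stub_malkinConeSteady` (the Malkin lever of the idea card `malkin-cone-group-orbits`)**: Malkin-visible
Goldstone steady witnesses are in `closure (interior LOUD)` at the same (strict) budgets — bordered steady persistence
(`stub_malkinBordered`) followed by the cone on the group orbit (`stub_borderedCone`). [folklore] -/
theorem stub_malkinConeSteady : ∀ (S : Finset (Fin 3 → ℤ)) (a E ε : ℝ), malkinSteady S a E ε ⊆ closure (interior (loud S a E ε)) :=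
  fun S a E ε => (MalkinBordered.stub_malkinBordered S a E ε).trans (BorderedCone.stub_borderedCone S a E ε)

end Summit.AnomalousDissipation.AnomalousDissipation.Theorems.RobustLoudUpgrade.MalkinConeSteady

end
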